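import Mathlib
import Summits.Ventures.HodgeRepro.Tier4.Common.KTypeProjector

/-!
# Tier4/Common/KTypeProjectorCompose — projectors of COMMUTING compact subgroups compose: the output of `e_{C₁,χ₁}`
keeps the `(C₂, χ₂)`-equivariance of its input when `C₁` and `C₂` commute elementwise, so `e_{C₁,χ₁} ∘ e_{C₂,χ₂}` lands
in the JOINT equivariant space

Blind re-derivation cell `pub-hodge-repro`, Tier 4 «prove the step» (README §9–§10), seat t4-typer-2 (gen 3).
Target tree path `lean/Summits/Ventures/HodgeRepro/Tier4/Common/KTypeProjectorCompose.lean`.  Mathlib +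
`Common.KTypeProjector`; no literature.

WHY (crit-1 S13839, consumption watch for the re-typed L4 wall: «the composition of the commuting per-place
projectors»): the `T′`-type space `kTypeSpace'` asks equivariance under the local tori `localTorusAt' W w` at EVERY
infinite place `w` and invariance under the level `K` — several compact subgroups at once; the projector of
`KTypeProjector` treats one `(C, χ)` at a time.  The bridge is the elementary fact below: `e_{C₁,χ₁}` is built from
right translates by `C₁`, so if `C₁` commutes with `C₂` it preserves right-`(C₂, χ₂)`-equivariance; hence
`e_{C₁,χ₁}(e_{C₂,χ₂} ψ)` is equivariant for BOTH (and so on along a finite family of pairwise commuting subgroups).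
The local tori at distinct places and the finite-part level commute elementwise (they are supported at different
places); that adelic fact is the consumer's to display or `Common`'s to add on request.

* `kProj_apply_mul_of_equivariant_of_commute` — `ψ` right-`(C₂, χ₂)`-equivariant, `C₁` commutes with `C₂` elementwise
  ⇒ `e_{C₁,χ₁} ψ` is right-`(C₂, χ₂)`-equivariant (no measure hypothesis: `integral_const_mul` is unconditional);
* `kProj_kProj_apply_mul_left`, `kProj_kProj_apply_mul_right` — `e_{C₁,χ₁}(e_{C₂,χ₂} ψ)` is equivariant under `C₁`
  (by `kProj_apply_mul`) and under `C₂` (by the above);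
* `kProj_of_equivariant_of_commute` — if `ψ` is already `(C₂, χ₂)`-equivariant and `(C₁, χ₁)`-equivariant, the
  composite fixes it (`kProj_of_equivariant` twice);
* `kProj_kProj_comm` — for commuting compact `C₁`, `C₂` (`ν₁`, `ν₂` finite, continuous data, `G` second countable)
  the two projectors COMMUTE: `e_{C₁,χ₁}(e_{C₂,χ₂} ψ) = e_{C₂,χ₂}(e_{C₁,χ₁} ψ)` (Fubini on `ν₁.prod ν₂`).

Nothing here says anything about the status of the Hodge conjecture for CM abelian varieties, which is NOT proved
(HC_CM is NOT proved by anyone in this repository).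
-/

set_option autoImplicit false

noncomputable section

namespace Summit.Ventures.HodgeRepro.Tier4.Common

open MeasureTheory Measure Topology Set
open scoped ComplexConjugate

section Compose

variable {G : Type*} [Group G] [TopologicalSpace G] [IsTopologicalGroup G] [MeasurableSpace G] [BorelSpace G]
  (C₁ C₂ : Subgroup G) (ν₁ : Measure C₁) (ν₂ : Measure C₂)

omit [TopologicalSpace G] [IsTopologicalGroup G] [BorelSpace G] in
/-- **The projector of `C₁` preserves `(C₂, χ₂)`-equivariance when `C₁` and `C₂` commute**: for `ψ (x κ₂) = χ₂(κ₂) ψ x`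
(`κ₂ ∈ C₂`) and `κ₁ κ₂ = κ₂ κ₁` (`κ₁ ∈ C₁`, `κ₂ ∈ C₂`), `e_{C₁,χ₁} ψ (x κ₂) = χ₂(κ₂) · e_{C₁,χ₁} ψ (x)`. -/
theorem kProj_apply_mul_of_equivariant_of_commute {χ₁ χ₂ ψ : G → ℂ}
    (hcomm : ∀ κ₁ ∈ C₁, ∀ κ₂ ∈ C₂, κ₁ * κ₂ = κ₂ * κ₁)
    (hψ : ∀ x, ∀ κ₂ ∈ C₂, ψ (x * κ₂) = χ₂ κ₂ * ψ x) (x : G) {κ₂ : G} (hκ₂ : κ₂ ∈ C₂) :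
    kProj C₁ ν₁ χ₁ ψ (x * κ₂) = χ₂ κ₂ * kProj C₁ ν₁ χ₁ ψ x := by
  simp only [kProj]
  rw [← integral_const_mul]
  congr 1
  funext κ₁
  rw [mul_assoc, ← hcomm κ₁ κ₁.2 κ₂ hκ₂, ← mul_assoc, hψ (x * κ₁) κ₂ hκ₂]
  ring

/-- The composite `e_{C₁,χ₁}(e_{C₂,χ₂} ψ)` is right-`(C₁, χ₁)`-equivariant (the outer projector). -/
theorem kProj_kProj_apply_mul_left [ν₁.IsMulLeftInvariant] {χ₁ χ₂ : G → ℂ}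
    (hχ₁ : ∀ a ∈ C₁, ∀ b ∈ C₁, χ₁ (a * b) = χ₁ a * χ₁ b) (hu₁ : ∀ a ∈ C₁, ‖χ₁ a‖ = 1) (ψ : G → ℂ) (x : G)
    {κ₁ : G} (hκ₁ : κ₁ ∈ C₁) :
    kProj C₁ ν₁ χ₁ (kProj C₂ ν₂ χ₂ ψ) (x * κ₁) = χ₁ κ₁ * kProj C₁ ν₁ χ₁ (kProj C₂ ν₂ χ₂ ψ) x :=
  kProj_apply_mul C₁ ν₁ hχ₁ hu₁ _ x hκ₁

/-- The composite `e_{C₁,χ₁}(e_{C₂,χ₂} ψ)` is right-`(C₂, χ₂)`-equivariant (the inner projector's equivariance survives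
the outer one when `C₁` and `C₂` commute). -/
theorem kProj_kProj_apply_mul_right [ν₂.IsMulLeftInvariant] {χ₁ χ₂ : G → ℂ}
    (hχ₂ : ∀ a ∈ C₂, ∀ b ∈ C₂, χ₂ (a * b) = χ₂ a * χ₂ b) (hu₂ : ∀ a ∈ C₂, ‖χ₂ a‖ = 1)
    (hcomm : ∀ κ₁ ∈ C₁, ∀ κ₂ ∈ C₂, κ₁ * κ₂ = κ₂ * κ₁) (ψ : G → ℂ) (x : G) {κ₂ : G} (hκ₂ : κ₂ ∈ C₂) :
    kProj C₁ ν₁ χ₁ (kProj C₂ ν₂ χ₂ ψ) (x * κ₂) = χ₂ κ₂ * kProj C₁ ν₁ χ₁ (kProj C₂ ν₂ χ₂ ψ) x :=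
  kProj_apply_mul_of_equivariant_of_commute C₁ C₂ ν₁ hcomm
    (fun y _ hκ => kProj_apply_mul C₂ ν₂ hχ₂ hu₂ ψ y hκ) x hκ₂

omit [TopologicalSpace G] [IsTopologicalGroup G] [BorelSpace G] in
/-- A function equivariant for both pairs is fixed by the composite projector. -/
theorem kProj_kProj_of_equivariant [IsProbabilityMeasure ν₁] [IsProbabilityMeasure ν₂] {χ₁ χ₂ : G → ℂ}
    (hu₁ : ∀ a ∈ C₁, ‖χ₁ a‖ = 1) (hu₂ : ∀ a ∈ C₂, ‖χ₂ a‖ = 1) {ψ : G → ℂ}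
    (hψ₁ : ∀ x, ∀ κ ∈ C₁, ψ (x * κ) = χ₁ κ * ψ x) (hψ₂ : ∀ x, ∀ κ ∈ C₂, ψ (x * κ) = χ₂ κ * ψ x) :
    kProj C₁ ν₁ χ₁ (kProj C₂ ν₂ χ₂ ψ) = ψ := by
  rw [kProj_of_equivariant C₂ ν₂ hu₂ hψ₂, kProj_of_equivariant C₁ ν₁ hu₁ hψ₁]

/-- **Projectors of commuting compact subgroups commute**: `e_{C₁,χ₁}(e_{C₂,χ₂} ψ) = e_{C₂,χ₂}(e_{C₁,χ₁} ψ)` for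
continuous `ψ` and characters (`C₁`, `C₂` compact spaces, `ν₁`, `ν₂` finite): Fubini on `ν₁.prod ν₂` and the
commutation `κ₁ κ₂ = κ₂ κ₁`. -/
theorem kProj_kProj_comm [SecondCountableTopology G] [CompactSpace C₁] [CompactSpace C₂] [IsFiniteMeasure ν₁]
    [IsFiniteMeasure ν₂] {χ₁ χ₂ : G → ℂ} (hχ₁c : Continuous fun κ : C₁ => χ₁ κ) (hχ₂c : Continuous fun κ : C₂ => χ₂ κ)
    (hcomm : ∀ κ₁ ∈ C₁, ∀ κ₂ ∈ C₂, κ₁ * κ₂ = κ₂ * κ₁) {ψ : G → ℂ} (hψ : Continuous ψ) :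
    kProj C₁ ν₁ χ₁ (kProj C₂ ν₂ χ₂ ψ) = kProj C₂ ν₂ χ₂ (kProj C₁ ν₁ χ₁ ψ) := by
  funext x
  haveI : SecondCountableTopology C₁ := Topology.IsInducing.subtypeVal.secondCountableTopology
  have hint : Integrable (Function.uncurry fun (κ₁ : C₁) (κ₂ : C₂) =>
      conj (χ₁ κ₁) * (conj (χ₂ κ₂) * ψ (x * κ₁ * κ₂))) (ν₁.prod ν₂) := by
    refine integrable_of_continuous_compactSpace (ν₁.prod ν₂) ?_
    refine Continuous.mul ((Complex.continuous_conj).comp (hχ₁c.comp continuous_fst)) ?_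
    refine Continuous.mul ((Complex.continuous_conj).comp (hχ₂c.comp continuous_snd)) ?_
    exact hψ.comp ((continuous_const.mul (continuous_subtype_val.comp continuous_fst)).mul
      (continuous_subtype_val.comp continuous_snd))
  calc kProj C₁ ν₁ χ₁ (kProj C₂ ν₂ χ₂ ψ) x
      = ∫ κ₁ : C₁, ∫ κ₂ : C₂, conj (χ₁ κ₁) * (conj (χ₂ κ₂) * ψ (x * κ₁ * κ₂)) ∂ν₂ ∂ν₁ := by
        simp only [kProj]
        congr 1
        funext κ₁
        rw [integral_const_mul]
    _ = ∫ κ₂ : C₂, ∫ κ₁ : C₁, conj (χ₁ κ₁) * (conj (χ₂ κ₂) * ψ (x * κ₁ * κ₂)) ∂ν₁ ∂ν₂ :=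
        integral_integral_swap hint
    _ = ∫ κ₂ : C₂, ∫ κ₁ : C₁, conj (χ₂ κ₂) * (conj (χ₁ κ₁) * ψ (x * κ₂ * κ₁)) ∂ν₁ ∂ν₂ := by
        congr 1
        funext κ₂
        congr 1
        funext κ₁
        rw [mul_assoc x, hcomm κ₁ κ₁.2 κ₂ κ₂.2, ← mul_assoc x]
        ring
    _ = kProj C₂ ν₂ χ₂ (kProj C₁ ν₁ χ₁ ψ) x := by
        simp only [kProj]
        congr 1
        funext κ₂
        rw [integral_const_mul]

end Compose

end Summit.Ventures.HodgeRepro.Tier4.Common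

end
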